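import Mathlib
import HarnessLib
import Summits.QuantumFields.YangMills.Theses.PencilRigidity
import Summits.QuantumFields.YangMills.Theorems.PencilRigidityCurvatureKernelBoundKernelExistence
import Summits.QuantumFields.YangMills.Theorems.PencilRigidityCurvatureKernelBoundHalfSpaceKernel
import Summits.QuantumFields.YangMills.Theorems.PencilRigidityCurvatureKernelBoundPartitionBump
import Summits.QuantumFields.YangMills.Theorems.PencilRigidityCurvatureKernelBoundLocalRepresentation

/-!
# `CurvatureKernelBound` — stub I₁ `KernelExistenceOfLocalDecay` (support for stmt-QuantumFields-11687, line `sixteen-charts-analytic-kernel`, skeleton v15)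

Stub `KernelExistenceOfLocalDecay` (I₁, pure bookkeeping): the continuum local two-point decay statement T
(`TwoPointLocalDecay`: for `W₁`-data, the local two-point bounds
`‖S₁ 2 (f₀ ⊗ f₁)‖ ≤ A ‖f₀‖₁ ‖f₁‖₁ + B r⁸ ‖f₀‖∞ ‖f₁‖∞` for real tensors supported in `r`-balls about `∓s e₀`, with constants
`A + B ≤ C s^(η−10)` for `0 < s < s₁`) implies kernel existence for `W₁`-data: a kernel `K`, continuous on `ℝ⁴ ∖ 0`, with
`S₁ 2 F = ∫ K(x₀ − x₁) F(x) dx` on `⁰𝒮₂`.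

Route: the landed kernel-existence engine X `KernelExistence` (fed with H `HalfSpaceKernel PartitionBump` and
R `LocalRepresentation`) consumes E2, translation invariance and proper-signed-permutation invariance on `⁰𝒮` (all clauses
of `W₁`) together with POLYNOMIALLY controlled local bounds `A + B ≤ A₀ (1 + s⁻¹ ^ p₀)` on `0 < s < s₁`; the decay
`C s^(η−10)` is polynomially controlled with `s₁' = min s₁ 1`, `A₀ = max C 0`, `p₀ = 10`, since
`s^(η−10) ≤ s^(−10) = s⁻¹ ^ 10 ≤ 1 + s⁻¹ ^ 10` for `0 < s ≤ 1`, `0 < η` (the rpow chain of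
`TwoPointLocal.two_mul_rpow_sub_ten_le`); the local-bound clause is passed through unchanged. [folklore]
-/

noncomputable section

open scoped BigOperators Topology SchwartzMap
open MeasureTheory Filter Set Metric
open Literature.MathematicalPhysics.QuantumLattice Literature.MathematicalPhysics.AQFT
open Literature.MathematicalPhysics.QuantumFieldTheory

namespace Summit.QuantumFields.YangMills.Theorems.CurvatureKernel

namespace KernelExistenceOfLocalDecayAux

/-- `s^(η−10) ≤ s⁻¹ ^ 10` for `0 < s ≤ 1`, `0 < η` (the rpow chain of `TwoPointLocal.two_mul_rpow_sub_ten_le`). [folklore] -/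
theorem rpow_sub_ten_le_inv_pow {η s : ℝ} (hη : 0 < η) (hs : 0 < s) (hs1 : s ≤ 1) :
    s ^ (η - 10) ≤ s⁻¹ ^ (10 : ℕ) := by
  -- adapted from TwoPointLocal.two_mul_rpow_sub_ten_le
  calc s ^ (η - 10) ≤ s ^ (-(10 : ℝ)) := Real.rpow_le_rpow_of_exponent_ge hs hs1 (by linarith)
    _ = s⁻¹ ^ (10 : ℕ) := by rw [Real.rpow_neg hs.le, ← Real.inv_rpow hs.le, Real.rpow_ofNat]

/-- Constant bookkeeping: `X ≤ C s^(η−10)` gives `X ≤ max C 0 · (1 + s⁻¹ ^ 10)` for `0 < s ≤ 1`, `0 < η`. [folklore] -/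
theorem le_max_mul_one_add_inv_pow {C η s X : ℝ} (hη : 0 < η) (hs : 0 < s) (hs1 : s ≤ 1)
    (hX : X ≤ C * s ^ (η - 10)) : X ≤ max C 0 * (1 + s⁻¹ ^ (10 : ℕ)) := by
  have h10 : (0 : ℝ) ≤ s⁻¹ ^ (10 : ℕ) := pow_nonneg (inv_nonneg.2 hs.le) _
  calc X ≤ C * s ^ (η - 10) := hX
    _ ≤ max C 0 * s ^ (η - 10) := mul_le_mul_of_nonneg_right (le_max_left _ _) (Real.rpow_nonneg hs.le _)
    _ ≤ max C 0 * s⁻¹ ^ (10 : ℕ) :=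
        mul_le_mul_of_nonneg_left (rpow_sub_ten_le_inv_pow hη hs hs1) (le_max_right _ _)
    _ ≤ max C 0 * (1 + s⁻¹ ^ (10 : ℕ)) := mul_le_mul_of_nonneg_left (by linarith) (le_max_right _ _)

end KernelExistenceOfLocalDecayAux

open KernelExistenceOfLocalDecayAux in
/-- **Stub I₁ `KernelExistenceOfLocalDecay`** (registered signature verbatim; skeleton v15 of line `sixteen-charts-analytic-kernel`).
The continuum local two-point decay statement T (constants `A + B ≤ C s^(η−10)`) implies, for every `W₁`-inhabitant, the
existence of a kernel continuous off `0` representing `S₁ 2` on `⁰𝒮₂`: T's constants are polynomially controlled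
(`s₁' = min s₁ 1`, `A₀ = max C 0`, `p₀ = 10`), and the landed engine `KernelExistence (HalfSpaceKernel PartitionBump)
LocalRepresentation` applies with E2, translations and proper signed permutations taken from `W₁`. See the module
docstring. [folklore] -/
theorem KernelExistenceOfLocalDecay : open Literature.MathematicalPhysics.QuantumLattice Literature.MathematicalPhysics.AQFT Literature.MathematicalPhysics.QuantumFieldTheory in (∀ (G : Type) [Group G] [TopologicalSpace G] [IsTopologicalGroup G] [CompactSpace G] [MeasurableSpace G] [BorelSpace G], IsCompactSimpleLieGroup G → ∀ (r : LatticeRep G) (sch : SpeciesScheme (YMSpecies G)) (S₁ : SchwingerFamily (EuclideanSpace ℝ (Fin 4))), ((∀ (n : ℕ), n ≠ 0 → ∀ (f : Fin n → SchwartzMap (EuclideanSpace ℝ (Fin 4)) ℝ) (F : SchwartzMap (Fin n → (EuclideanSpace ℝ (Fin 4))) ℂ), IsTensorOf F (fun i => ofRealTest (f i)) → IsOffDiagonal F → Filter.Tendsto (fun k : ℕ => ((latticeSchwinger r.ρ sch (fun s => s.F) k n (fun _ => r.curvature) f : ℝ) : ℂ)) Filter.atTop (nhds (S₁ n F))) ∧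 (S₁.toLabelled.IsNormalized ∧ S₁.toLabelled.IsHermitian ∧ S₁.toLabelled.HasLinearGrowth ∧ S₁.toLabelled.IsReflectionPositive ∧ S₁.toLabelled.IsSymmetric ∧ S₁.toLabelled.HasClusterProperty) ∧ (∀ (n : ℕ) (a : (EuclideanSpace ℝ (Fin 4))) (F : SchwartzMap (Fin n → (EuclideanSpace ℝ (Fin 4))) ℂ), IsOffDiagonal F → S₁ n (translateMulti a F) = S₁ n F) ∧ (∀ (R : (EuclideanSpace ℝ (Fin 4)) ≃ₗᵢ[ℝ] (EuclideanSpace ℝ (Fin 4))), LinearMap.det (R.toLinearEquiv : (EuclideanSpace ℝ (Fin 4)) →ₗ[ℝ] (EuclideanSpace ℝ (Fin 4))) = 1 → (∀ i : Fin 4, ∃ j : Fin 4, R (EuclideanSpace.single i 1) = EuclideanSpace.single j 1 ∨ R (EuclideanSpace.single i 1) = -EuclideanSpace.single j 1) → ∀ (n : ℕ) (F : SchwartzMap (Fin n → (EuclideanSpace ℝ (Fin 4))) ℂ), IsOffDiagonal F → S₁ n (linActMulti R F) = S₁ n F) ∧ (∃ Δ : ℝ, 0 < Δ ∧ S₁.toLabelled.HasMassGap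 Δ ∧ HasLatticeMassGap r sch Δ)) → ∃ (C η s₁ : ℝ), 0 < η ∧ 0 < s₁ ∧ (∀ (s : ℝ), 0 < s → s < s₁ → ∃ (r₀ A B : ℝ), 0 < r₀ ∧ 0 ≤ A ∧ 0 ≤ B ∧ A + B ≤ C * s ^ (η - 10) ∧ (∀ (r : ℝ), 0 < r → r ≤ r₀ → ∀ (f : Fin 2 → SchwartzMap (EuclideanSpace ℝ (Fin 4)) ℝ) (F : SchwartzMap (Fin 2 → (EuclideanSpace ℝ (Fin 4))) ℂ) (M₀ M₁ : ℝ), IsTensorOf F (fun i => ofRealTest (f i)) → tsupport ((f 0 : SchwartzMap (EuclideanSpace ℝ (Fin 4)) ℝ) : (EuclideanSpace ℝ (Fin 4)) → ℝ) ⊆ Metric.closedBall (EuclideanSpace.single (0 : Fin 4) (-s)) r → tsupport ((f 1 : SchwartzMap (EuclideanSpace ℝ (Fin 4)) ℝ) : (EuclideanSpace ℝ (Fin 4)) → ℝ) ⊆ Metric.closedBall (EuclideanSpace.single (0 : Fin 4) s) r → (∀ x, |f 0 x| ≤ M₀) → (∀ x, |f 1 x| ≤ M₁) → ‖S₁ 2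 F‖ ≤ A * (∫ x : (EuclideanSpace ℝ (Fin 4)), |f 0 x|) * (∫ x : (EuclideanSpace ℝ (Fin 4)), |f 1 x|) + B * r ^ 8 * M₀ * M₁))) → ∀ (G : Type) [Group G] [TopologicalSpace G] [IsTopologicalGroup G] [CompactSpace G] [MeasurableSpace G] [BorelSpace G], IsCompactSimpleLieGroup G → ∀ (r : LatticeRep G) (sch : SpeciesScheme (YMSpecies G)) (S₁ : SchwingerFamily (EuclideanSpace ℝ (Fin 4))), ((∀ (n : ℕ), n ≠ 0 → ∀ (f : Fin n → SchwartzMap (EuclideanSpace ℝ (Fin 4)) ℝ) (F : SchwartzMap (Fin n → (EuclideanSpace ℝ (Fin 4))) ℂ), IsTensorOf F (fun i => ofRealTest (f i)) → IsOffDiagonal F → Filter.Tendsto (fun k : ℕ => ((latticeSchwinger r.ρ sch (fun s => s.F) k n (fun _ => r.curvature) f : ℝ) : ℂ)) Filter.atTop (nhds (S₁ n F))) ∧ (S₁.toLabelled.IsNormalized ∧ S₁.toLabelled.IsHermitian ∧ S₁.toLabelled.HasLinearGrowth ∧ S₁.toLabelled.IsReflectionPositive ∧ S₁.toLabelled.IsSymmetric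 ∧ S₁.toLabelled.HasClusterProperty) ∧ (∀ (n : ℕ) (a : (EuclideanSpace ℝ (Fin 4))) (F : SchwartzMap (Fin n → (EuclideanSpace ℝ (Fin 4))) ℂ), IsOffDiagonal F → S₁ n (translateMulti a F) = S₁ n F) ∧ (∀ (R : (EuclideanSpace ℝ (Fin 4)) ≃ₗᵢ[ℝ] (EuclideanSpace ℝ (Fin 4))), LinearMap.det (R.toLinearEquiv : (EuclideanSpace ℝ (Fin 4)) →ₗ[ℝ] (EuclideanSpace ℝ (Fin 4))) = 1 → (∀ i : Fin 4, ∃ j : Fin 4, R (EuclideanSpace.single i 1) = EuclideanSpace.single j 1 ∨ R (EuclideanSpace.single i 1) = -EuclideanSpace.single j 1) → ∀ (n : ℕ) (F : SchwartzMap (Fin n → (EuclideanSpace ℝ (Fin 4))) ℂ), IsOffDiagonal F → S₁ n (linActMulti R F) = S₁ n F) ∧ (∃ Δ : ℝ, 0 < Δ ∧ S₁.toLabelled.HasMassGap Δ ∧ HasLatticeMassGap r sch Δ)) → ∃ K : (EuclideanSpace ℝ (Fin 4)) → ℂ, ContinuousOn K {x : (EuclideanSpace ℝ (Fin 4)) |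 x ≠ 0} ∧ ∀ F : SchwartzMap (Fin 2 → (EuclideanSpace ℝ (Fin 4))) ℂ, IsOffDiagonal F → MeasureTheory.Integrable (fun x : Fin 2 → (EuclideanSpace ℝ (Fin 4)) => K (x 0 - x 1) * F x) ∧ S₁ 2 F = ∫ x : Fin 2 → (EuclideanSpace ℝ (Fin 4)), K (x 0 - x 1) * F x := by
  intro hT G _ _ _ _ _ _ hG r sch S₁ hW₁
  -- T's constants are polynomially controlled: `C s^(η−10) ≤ max C 0 · (1 + s⁻¹ ^ 10)` on `0 < s < min s₁ 1`
  have hLBF : ∃ (s₁ A₀ : ℝ) (p₀ : ℕ), 0 < s₁ ∧ 0 ≤ A₀ ∧ (∀ (s : ℝ), 0 < s → s < s₁ → ∃ (r₀ A B : ℝ), 0 < r₀ ∧ 0 ≤ A ∧ 0 ≤ B ∧ A + B ≤ A₀ * (1 + s⁻¹ ^ p₀) ∧ (∀ (r : ℝ), 0 < r → r ≤ r₀ → ∀ (f : Fin 2 → SchwartzMap (EuclideanSpace ℝ (Fin 4)) ℝ) (F : SchwartzMap (Fin 2 → (EuclideanSpace ℝ (Fin 4))) ℂ) (M₀ M₁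 : ℝ), IsTensorOf F (fun i => ofRealTest (f i)) → tsupport ((f 0 : SchwartzMap (EuclideanSpace ℝ (Fin 4)) ℝ) : (EuclideanSpace ℝ (Fin 4)) → ℝ) ⊆ Metric.closedBall (EuclideanSpace.single (0 : Fin 4) (-s)) r → tsupport ((f 1 : SchwartzMap (EuclideanSpace ℝ (Fin 4)) ℝ) : (EuclideanSpace ℝ (Fin 4)) → ℝ) ⊆ Metric.closedBall (EuclideanSpace.single (0 : Fin 4) s) r → (∀ x, |f 0 x| ≤ M₀) → (∀ x, |f 1 x| ≤ M₁) → ‖S₁ 2 F‖ ≤ A * (∫ x : (EuclideanSpace ℝ (Fin 4)), |f 0 x|) * (∫ x : (EuclideanSpace ℝ (Fin 4)), |f 1 x|) + B * r ^ 8 * M₀ * M₁)) := by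
    obtain ⟨C, η, s₁, hη, hs₁, hdec⟩ := hT G hG r sch S₁ hW₁
    refine ⟨min s₁ 1, max C 0, 10, lt_min hs₁ one_pos, le_max_right _ _, ?_⟩
    intro s hs hs'
    obtain ⟨r₀, A, B, hr₀, hA, hB, hAB, hLB⟩ := hdec s hs (lt_of_lt_of_le hs' (min_le_left _ _))
    exact ⟨r₀, A, B, hr₀, hA, hB,
      le_max_mul_one_add_inv_pow hη hs (hs'.le.trans (min_le_right _ _)) hAB, hLB⟩
  -- the landed engine X, fed with H (from P) and R, and the `W₁` clauses E2 / translations / proper signed permutations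
  exact Summit.QuantumFields.YangMills.Theorems.CurvatureKernel.KernelExistence
    (Summit.QuantumFields.YangMills.Theorems.CurvatureKernel.HalfSpaceKernel
      Summit.QuantumFields.YangMills.Theorems.CurvatureKernel.PartitionBump)
    Summit.QuantumFields.YangMills.Theorems.CurvatureKernel.LocalRepresentation S₁ hW₁.2.1.2.2.2.1 hW₁.2.2.1
    hW₁.2.2.2.1 hLBF

/-- **Sub-goal `KernelExistenceOfLocalDecayLet`**: the stub `KernelExistenceOfLocalDecay` in `let E := ℝ⁴; let X := E²` form
(the same proposition up to unfolding the `let`s; registered because the expanded statement of the stub exceeds the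
ledger's length limit for stub signatures and was stored truncated, as for `KernelExistenceLet`). [folklore] -/
theorem KernelExistenceOfLocalDecayLet : open Literature.MathematicalPhysics.QuantumLattice Literature.MathematicalPhysics.AQFT Literature.MathematicalPhysics.QuantumFieldTheory in let E := EuclideanSpace ℝ (Fin 4); let X := Fin 2 → E; (∀ (G : Type) [Group G] [TopologicalSpace G] [IsTopologicalGroup G] [CompactSpace G] [MeasurableSpace G] [BorelSpace G], IsCompactSimpleLieGroup G → ∀ (r : LatticeRep G) (sch : SpeciesScheme (YMSpecies G)) (S₁ : SchwingerFamily E), ((∀ (n : ℕ), n ≠ 0 → ∀ (f : Fin n → SchwartzMap E ℝ) (F : SchwartzMap (Fin n → E) ℂ), IsTensorOf F (fun i => ofRealTest (f i)) → IsOffDiagonal F → Filter.Tendsto (fun k : ℕ => ((latticeSchwinger r.ρ sch (fun s => s.F) k n (fun _ => r.curvature) f : ℝ) : ℂ)) Filter.atTop (nhds (S₁ n F))) ∧ (S₁.toLabelled.IsNormalized ∧ S₁.toLabelled.IsHermitian ∧ S₁.toLabelled.HasLinearGrowth ∧ S₁.toLabelled.IsReflectionPositive ∧ S₁.toLabelled.IsSymmetric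 ∧ S₁.toLabelled.HasClusterProperty) ∧ (∀ (n : ℕ) (a : E) (F : SchwartzMap (Fin n → E) ℂ), IsOffDiagonal F → S₁ n (translateMulti a F) = S₁ n F) ∧ (∀ (R : E ≃ₗᵢ[ℝ] E), LinearMap.det (R.toLinearEquiv : E →ₗ[ℝ] E) = 1 → (∀ i : Fin 4, ∃ j : Fin 4, R (EuclideanSpace.single i 1) = EuclideanSpace.single j 1 ∨ R (EuclideanSpace.single i 1) = -EuclideanSpace.single j 1) → ∀ (n : ℕ) (F : SchwartzMap (Fin n → E) ℂ), IsOffDiagonal F → S₁ n (linActMulti R F) = S₁ n F) ∧ (∃ Δ : ℝ, 0 < Δ ∧ S₁.toLabelled.HasMassGap Δ ∧ HasLatticeMassGap r sch Δ)) → ∃ (C η s₁ : ℝ), 0 < η ∧ 0 < s₁ ∧ (∀ (s : ℝ), 0 < s → s < s₁ → ∃ (r₀ A B : ℝ), 0 < r₀ ∧ 0 ≤ A ∧ 0 ≤ B ∧ A + B ≤ C * s ^ (η - 10) ∧ (∀ (r : ℝ), 0 < r → r ≤ r₀ → ∀ (f : Fin 2 → SchwartzMap E ℝ) (F : SchwartzMap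 X ℂ) (M₀ M₁ : ℝ), IsTensorOf F (fun i => ofRealTest (f i)) → tsupport ((f 0 : SchwartzMap E ℝ) : E → ℝ) ⊆ Metric.closedBall (EuclideanSpace.single (0 : Fin 4) (-s)) r → tsupport ((f 1 : SchwartzMap E ℝ) : E → ℝ) ⊆ Metric.closedBall (EuclideanSpace.single (0 : Fin 4) s) r → (∀ x, |f 0 x| ≤ M₀) → (∀ x, |f 1 x| ≤ M₁) → ‖S₁ 2 F‖ ≤ A * (∫ x : E, |f 0 x|) * (∫ x : E, |f 1 x|) + B * r ^ 8 * M₀ * M₁))) → ∀ (G : Type) [Group G] [TopologicalSpace G] [IsTopologicalGroup G] [CompactSpace G] [MeasurableSpace G] [BorelSpace G], IsCompactSimpleLieGroup G → ∀ (r : LatticeRep G) (sch : SpeciesScheme (YMSpecies G)) (S₁ : SchwingerFamily E), ((∀ (n : ℕ), n ≠ 0 → ∀ (f : Fin n → SchwartzMap E ℝ) (F : SchwartzMap (Fin n → E) ℂ), IsTensorOf F (fun i => ofRealTest (f i)) → IsOffDiagonal F → Filter.Tendsto (fun k : ℕ => ((latticeSchwinger r.ρ sch (fun s => s.F) k n (fun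 _ => r.curvature) f : ℝ) : ℂ)) Filter.atTop (nhds (S₁ n F))) ∧ (S₁.toLabelled.IsNormalized ∧ S₁.toLabelled.IsHermitian ∧ S₁.toLabelled.HasLinearGrowth ∧ S₁.toLabelled.IsReflectionPositive ∧ S₁.toLabelled.IsSymmetric ∧ S₁.toLabelled.HasClusterProperty) ∧ (∀ (n : ℕ) (a : E) (F : SchwartzMap (Fin n → E) ℂ), IsOffDiagonal F → S₁ n (translateMulti a F) = S₁ n F) ∧ (∀ (R : E ≃ₗᵢ[ℝ] E), LinearMap.det (R.toLinearEquiv : E →ₗ[ℝ] E) = 1 → (∀ i : Fin 4, ∃ j : Fin 4, R (EuclideanSpace.single i 1) = EuclideanSpace.single j 1 ∨ R (EuclideanSpace.single i 1) = -EuclideanSpace.single j 1) → ∀ (n : ℕ) (F : SchwartzMap (Fin n → E) ℂ), IsOffDiagonal F → S₁ n (linActMulti R F) = S₁ n F) ∧ (∃ Δ : ℝ, 0 < Δ ∧ S₁.toLabelled.HasMassGap Δ ∧ HasLatticeMassGap r sch Δ)) → ∃ K : E → ℂ, ContinuousOn K {x : E | x ≠ 0} ∧ ∀ F : SchwartzMap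 X ℂ, IsOffDiagonal F → MeasureTheory.Integrable (fun x : X => K (x 0 - x 1) * F x) ∧ S₁ 2 F = ∫ x : X, K (x 0 - x 1) * F x := by
  intro E X
  exact KernelExistenceOfLocalDecay

end Summit.QuantumFields.YangMills.Theorems.CurvatureKernel

end
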